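import Mathlib.Analysis.InnerProductSpace.Basic

/-!
# «SoftSplit» toy rung — the STIFF-COMPONENT LEMMA (the linear step of a Lyapunov–Schmidt splitting)

decomp-a2c lens-5 g85, companion of `…StrainedPatchSoftSplit` (Mathlib-only, def-free).  The mechanism the stiff leaves (T) `RefineGBS` / (K_S)
`FamilyCoverGS` invoke, in its cleanest finite form: for a symmetric operator `H` (the host's block Hessian on the charted ball), an `H`-invariant
subspace `W` (the STIFF subspace: span of the eigenvectors with eigenvalue `≥ λ`) on which `H` is `λ`-coercive, and a displacement `u = w + v` split
into its stiff part `w ∈ W` and a soft part `v ⊥ W`, the stiff part is controlled by the RESIDUAL FORCE alone: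

  `λ · ‖w‖ ≤ ‖H u‖`                                   (`stiff_component_le`, `stiff_component_bound`: `‖w‖ ≤ f/λ` under the force cap `‖H u‖ ≤ f`),

while the force is BLIND to kernel directions (`force_blind_to_kernel`: `H (w + v) = H w` when `H v = 0`) — the soft part is NOT controlled at linear
order, which is why (S) `SoftEnvelope` is a separate (anharmonic) leaf.  Reading for the record cluster: `f = σ₁·√N` (force cap on the `N ≈ 1.6·10³`
ball sites), `λ` = the host's stiff gap ⇒ stiff residual `‖w‖₂ ≤ σ₁√N/λ`, i.e. r.m.s. `σ₁/λ` per site (`≈ 0.0108/λ`); the soft amplitude is whatever the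
anharmonic balance and the window allow (instrument «SOFT-85»).  [formal toy; standard axioms; 0 sorry]
-/

namespace Summit.AtomisticToContinuum.Crystallization.Theorems.FrustratedLawDichotomyStrainedPatchSoftSplitToy

open scoped RealInnerProductSpace

variable {V : Type*} [NormedAddCommGroup V] [InnerProductSpace ℝ V]

/-- ★ THE STIFF-COMPONENT LEMMA: `H` symmetric, `W` `H`-invariant and `λ`-coercive, `u = w + v` with `w ∈ W`, `v ⊥ W` ⟹ `λ‖w‖² ≤ ‖H u‖·‖w‖`.
[folklore: `⟨H u, w⟩ = ⟨H w, w⟩ + ⟨v, H w⟩ = ⟨H w, w⟩`, Cauchy–Schwarz] -/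
theorem stiff_component_le (H : V →ₗ[ℝ] V) (W : Submodule ℝ V) (lam : ℝ) (hsym : ∀ x y : V, ⟪H x, y⟫ = ⟪x, H y⟫)
    (hinv : ∀ w ∈ W, H w ∈ W) (hcoer : ∀ w ∈ W, lam * ‖w‖ ^ 2 ≤ ⟪H w, w⟫) {u w v : V} (hu : u = w + v) (hw : w ∈ W)
    (hv : ∀ w' ∈ W, ⟪v, w'⟫ = 0) : lam * ‖w‖ ^ 2 ≤ ‖H u‖ * ‖w‖ := by
  have h1 : ⟪H u, w⟫ = ⟪H w, w⟫ := by
    rw [hu, map_add, inner_add_left, hsym v w, hv (H w) (hinv w hw), add_zero]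
  calc lam * ‖w‖ ^ 2 ≤ ⟪H w, w⟫ := hcoer w hw
    _ = ⟪H u, w⟫ := h1.symm
    _ ≤ ‖H u‖ * ‖w‖ := real_inner_le_norm _ _

/-- ★ … hence `λ‖w‖ ≤ ‖H u‖`. [folklore] -/
theorem stiff_component_le' (H : V →ₗ[ℝ] V) (W : Submodule ℝ V) (lam : ℝ) (hsym : ∀ x y : V, ⟪H x, y⟫ = ⟪x, H y⟫)
    (hinv : ∀ w ∈ W, H w ∈ W) (hcoer : ∀ w ∈ W, lam * ‖w‖ ^ 2 ≤ ⟪H w, w⟫) {u w v : V} (hu : u = w + v) (hw : w ∈ W)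
    (hv : ∀ w' ∈ W, ⟪v, w'⟫ = 0) : lam * ‖w‖ ≤ ‖H u‖ := by
  by_cases hw0 : w = 0
  · simp [hw0]
  · have hpos : 0 < ‖w‖ := norm_pos_iff.2 hw0
    have h := stiff_component_le H W lam hsym hinv hcoer hu hw hv
    have h' : (lam * ‖w‖) * ‖w‖ ≤ ‖H u‖ * ‖w‖ := by
      calc (lam * ‖w‖) * ‖w‖ = lam * ‖w‖ ^ 2 := by ring
        _ ≤ ‖H u‖ * ‖w‖ := h
    exact le_of_mul_le_mul_right h' hpos

/-- ★ … and under a FORCE CAP `‖H u‖ ≤ f` with a positive stiff gap: `‖w‖ ≤ f/λ` — the stiff residual is slaved to the cap. [folklore] -/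
theorem stiff_component_bound (H : V →ₗ[ℝ] V) (W : Submodule ℝ V) {lam f : ℝ} (hlam : 0 < lam) (hsym : ∀ x y : V, ⟪H x, y⟫ = ⟪x, H y⟫)
    (hinv : ∀ w ∈ W, H w ∈ W) (hcoer : ∀ w ∈ W, lam * ‖w‖ ^ 2 ≤ ⟪H w, w⟫) {u w v : V} (hu : u = w + v) (hw : w ∈ W)
    (hv : ∀ w' ∈ W, ⟪v, w'⟫ = 0) (hf : ‖H u‖ ≤ f) : ‖w‖ ≤ f / lam := by
  rw [le_div_iff₀ hlam, mul_comm]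
  exact (stiff_component_le' H W lam hsym hinv hcoer hu hw hv).trans hf

/-- ★ THE SOFT SIDE IS INVISIBLE TO THE FORCE at linear order: a kernel direction adds nothing to `H u`.  (So no statement of the shape «force cap ⟹
small soft amplitude» holds at linear order — (S) is anharmonic or kinematic, never a corollary of (T)'s mechanism.) [formal bookkeeping] -/
theorem force_blind_to_kernel (H : V →ₗ[ℝ] V) {v : V} (hv : H v = 0) (w : V) : H (w + v) = H w := by
  rw [map_add, hv, add_zero]

end Summit.AtomisticToContinuum.Crystallization.Theorems.FrustratedLawDichotomyStrainedPatchSoftSplitToy
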